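import Summits.AtomisticToContinuum.Crystallization.Theorems.FreeSplittingCertificatesStrictSplittingRuleTorusModel442Defs
import Summits.AtomisticToContinuum.Crystallization.Theorems.PalmUnimodularRigidityLayeredLawsSelectHcpZeroStressSymmetry

/-!
# Torus model 4×4×2: its geometry and Lennard-Jones data ARE the tree's (`hcpSite`, `ljSqDeriv`) — fidelity lemmas

Route `FreeSplittingCertificates`, crux `StrictSplittingRule` (stmt-AtomisticToContinuum-12560); unit b2b-freesplit-B (block 2b,
PART B, gen 1).  VALUE = fidelity of a FINITE model — NOT summit progress.

The model of `…TorusModel442Defs.lean` is written in the scaled rational frame `(x, y/√3, z)` with its own relative-position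
function `V b d` and weights `ljW1`, `ljW2`.  Kernel-checked here (no computation):
* `hcpSite_sub_eq_V` — for all integer sites `p` and offsets `d`, the tree's hcp geometry at the model's lattice parameters,
  `hcpSite a₀ h₀ (p + d) − hcpSite a₀ h₀ p` (`hcpSite = barlowPos a h alternatingHagg`, file `…LayeredLawsSelectHcpDefs.lean`), has
  Cartesian coordinates `(V₀, √3·V₁, V₂)` with `V = V (Even p.1) d`: the model's geometry IS the crux's geometry (periodic images
  on the torus are then the lattice offsets `d` the model sums over);
* `ipG_eq_inner3` — the model's `⟨x, y⟩_G = x₀y₀ + 3x₁y₁ + x₂y₂` is the Euclidean inner product of the unscaled vectors;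
* `ljW1_cast`, `ljW2_cast` — the model's `W′`, `W″` are `ljSqDeriv` and the `½(7s⁻⁸ − 4s⁻⁵)` of `CoreJointSiteIneq`
  (the terms use them rounded to 60 fractional bits, `rnd 60`, as documented in the Defs file).
-/

namespace Summit.AtomisticToContinuum.Crystallization.Theorems.StrictSplittingRuleTorusLMI

open Summit.AtomisticToContinuum.Crystallization.Theorems.PalmUnimodularRigidity.LayeredLawsSelectHcp
open Literature.MathematicalPhysics.StatisticalMechanics

/-- The scaled-frame inner product is the Euclidean one of the unscaled vectors `(x₀, √3 x₁, x₂)`. [folklore] -/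
theorem ipG_eq_inner3 (x y : Fin 3 → ℚ) :
    ((ipG x y : ℚ) : ℝ) = (x 0 : ℝ) * (y 0 : ℝ) + (Real.sqrt 3 * (x 1 : ℝ)) * (Real.sqrt 3 * (y 1 : ℝ)) + (x 2 : ℝ) * (y 2 : ℝ) := by
  have h3 : Real.sqrt 3 * Real.sqrt 3 = 3 := Real.mul_self_sqrt (by norm_num)
  have e : (Real.sqrt 3 * (x 1 : ℝ)) * (Real.sqrt 3 * (y 1 : ℝ)) = (Real.sqrt 3 * Real.sqrt 3) * ((x 1 : ℝ) * (y 1 : ℝ)) := by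
    ring
  rw [e, h3]
  simp only [ipG, gW, show ((0 : Fin 3) = 1) = False from by decide, show ((2 : Fin 3) = 1) = False from by decide,
    if_true, if_false]
  push_cast
  ring

/-- The model's `W′` is the tree's `ljSqDeriv` (cast `ℚ → ℝ`). [folklore] -/
theorem ljW1_cast (s : ℚ) : ((ljW1 s : ℚ) : ℝ) = ljSqDeriv (s : ℝ) := by
  simp only [ljW1, ljSqDeriv]; push_cast; ring

/-- The model's `W″` is the coefficient `½(7s⁻⁸ − 4s⁻⁵)` of `CoreJointSiteIneq` (cast `ℚ → ℝ`). [folklore] -/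
theorem ljW2_cast (s : ℚ) : ((ljW2 s : ℚ) : ℝ) = 1 / 2 * (7 * ((s : ℝ)⁻¹) ^ 8 - 4 * ((s : ℝ)⁻¹) ^ 5) := by
  simp only [ljW2]; push_cast; ring

/-- `L(k) = 0` for even `k`. [folklore] -/
theorem Lk_of_even {k : ℤ} (hk : Even k) : Lk k = 0 := by
  unfold Lk; exact Int.even_iff.mp hk
/-- `L(k) = 1` for odd `k`. [folklore] -/
theorem Lk_of_odd {k : ℤ} (hk : Odd k) : Lk k = 1 := by
  unfold Lk; exact Int.odd_iff.mp hk

/-- The model's relative position `V b d` IS the tree's hcp geometry: for integer sites `p`, `q = p + d`,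
`hcpSite a₀ h₀ q − hcpSite a₀ h₀ p = (V₀, √3·V₁, V₂)` with `V = V (Even p.1) d` (scaled frame `(x, y/√3, z)`). -/
theorem hcpSite_sub_eq_V (p d : ℤ × ℤ × ℤ) :
    (hcpSite (a0 : ℝ) (h0 : ℝ) (p + d) - hcpSite (a0 : ℝ) (h0 : ℝ) p) 0 = ((V (decide (Even p.1)) d 0 : ℚ) : ℝ) ∧
    (hcpSite (a0 : ℝ) (h0 : ℝ) (p + d) - hcpSite (a0 : ℝ) (h0 : ℝ) p) 1 =
      Real.sqrt 3 * ((V (decide (Even p.1)) d 1 : ℚ) : ℝ) ∧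
    (hcpSite (a0 : ℝ) (h0 : ℝ) (p + d) - hcpSite (a0 : ℝ) (h0 : ℝ) p) 2 = ((V (decide (Even p.1)) d 2 : ℚ) : ℝ) := by
  have f10 : ((1 : Fin 3) = 0) = False := by decide
  have f20 : ((2 : Fin 3) = 0) = False := by decide
  have f21 : ((2 : Fin 3) = 1) = False := by decide
  simp only [PiLp.sub_apply, hcpSite_apply_zero, hcpSite_apply_one, hcpSite_apply_two, haggLabel_alternating,
    Prod.fst_add, Prod.snd_add, V, f10, f20, f21, ↓reduceIte]
  rcases Int.even_or_odd p.1 with hp | hp <;> rcases Int.even_or_odd d.1 with hd | hd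
  · have hpd : Even (p.1 + d.1) := hp.add hd
    simp only [hp, hpd, decide_true, ↓reduceIte, Lk_of_even hd, Lk_of_even (show Even (0:ℤ) from ⟨0, rfl⟩), zero_add]
    push_cast; refine ⟨?_, ?_, ?_⟩ <;> ring
  · have hpd : ¬ Even (p.1 + d.1) := by rw [Int.not_even_iff_odd]; exact hp.add_odd hd
    simp only [hp, hpd, decide_true, ↓reduceIte, zero_add, Lk_of_odd hd, Lk_of_even (show Even (0:ℤ) from ⟨0, rfl⟩)]
    push_cast; refine ⟨?_, ?_, ?_⟩ <;> ring
  · have hpd : ¬ Even (p.1 + d.1) := by rw [Int.not_even_iff_odd]; exact hp.add_even hd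
    have hp' : ¬ Even p.1 := Int.not_even_iff_odd.mpr hp
    have h1 : Lk (1 + d.1) = 1 := Lk_of_odd (by simpa [add_comm] using hd.one_add)
    simp only [hp', hpd, decide_false, Bool.false_eq_true, ↓reduceIte, h1, Lk_of_odd odd_one]
    push_cast; refine ⟨?_, ?_, ?_⟩ <;> ring
  · have hpd : Even (p.1 + d.1) := hp.add_odd hd
    have hp' : ¬ Even p.1 := Int.not_even_iff_odd.mpr hp
    have h1 : Lk (1 + d.1) = 0 := Lk_of_even (by simpa [add_comm] using hd.add_odd odd_one)
    simp only [hp', hpd, decide_false, Bool.false_eq_true, ↓reduceIte, h1, Lk_of_odd odd_one]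
    push_cast; refine ⟨?_, ?_, ?_⟩ <;> ring

end Summit.AtomisticToContinuum.Crystallization.Theorems.StrictSplittingRuleTorusLMI
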